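import Literature.Geometry.Riemannian.ShrinkerEntropyProofs
import Summits.SmoothPoincare4.SmoothPoincare4.Theorems.EntropyRungNoncompactShrinkerGapCarrilloNiClauses
import Summits.SmoothPoincare4.SmoothPoincare4.Theorems.EntropyRungNoncompactShrinkerGapReduction
import HarnessLib

/-!
# The `𝒲`-form of the compact-support LSI from its entropy form (crux
# `EntropyRung.NoncompactShrinkerGap`, stmt-SmoothPoincare4-10868, line `collapsed-ends-usc`, v13)

Helper `helper_wForm_of_entForm` of the heat-flow skeleton for `stub_compactSupportLSI`. On a
complete connected gradient shrinking Ricci soliton `(Mⁿ, g, f)` (`Ric + Hess f = g/2`, normalised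
by `R + |∇f|² = f`), ASSUME the logarithmic Sobolev inequality of the shrinker measure `e^{-f} dV`
in entropy form, for every smooth compactly supported `v`,
`∫ v² log v² e^{-f} − m log (m/Z) ≤ 4 ∫ |∇v|² e^{-f}`, `m = ∫ v² e^{-f}`, `Z = ∫ e^{-f}`.
THEN for every smooth compactly supported `w` with `∫ w² > 0` Perelman's `𝒲`-form holds:
`log((4π)^{-n/2} Z) ≤ (∫ (R w² + 4|∇w|² − w² log w²))/∫w² + log ∫w² + log (4π)^{-n/2} − n`
(`wForm_of_entForm`, any `n`; the registered stub `helper_wForm_of_entForm` is `n = 4`, where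
`log (4π)^{-2} = −log (4π)²`).

The proof is the substitution `v = w e^{f/2}` (smooth, same compact support): pointwise
`v² e^{-f} = w²`, `v² log v² e^{-f} = w² log w² + f w²`, and, by the Leibniz and chain rules
`dv = e^{f/2} (dw + (w/2) df)`,
`|∇v|² e^{-f} = |∇w|² + w g⁻¹(dw, df) + ¼ w² |∇f|²`.
Green's first identity for the compactly supported `w²` (`GreenIdentityCompactSupport.lean`) and
the traced soliton equation `Δf = n/2 − R` give `2 ∫ w g⁻¹(dw, df) = −∫ w² Δf = ∫ R w² − (n/2) ∫ w²`,
and `|∇f|² = f − R`; the `f`-terms cancel and the entropy form for `v` becomes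
`∫ w² log w² − m log m + m log Z ≤ ∫ (R w² + 4|∇w|²) − n m`, `m = ∫ w²`, which is the claim.
All integrands are continuous with compact support; `Z > 0` by Carrillo–Ni's Thm. 1.1 (i)
(`carrilloNi_integrable_exp_neg`, `integral_exp_neg_pos`).

References: [CarrilloNi2009] J. A. Carrillo, L. Ni, Comm. Anal. Geom. 17 (2009) 721–753, §4
(the passage between the LSI and the `𝒲`-functional); [HaslhoferMuller2011] R. Haslhofer,
R. Müller, GAFA 21 (2011) 1091–1116, (2.15)–(2.16).
-/

noncomputable section

set_option linter.dupNamespace false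

open scoped Manifold ContDiff ENNReal NNReal Topology
open MeasureTheory Set Filter
open Literature.Geometry.Lorentzian Literature.Geometry.Riemannian

namespace Summit.SmoothPoincare4.SmoothPoincare4.Theorems.NoncompactShrinkerGapHeat

open Summit.SmoothPoincare4.SmoothPoincare4.Theorems.NoncompactShrinkerGapCarrilloNiClauses
open Summit.SmoothPoincare4.SmoothPoincare4.Theorems.NoncompactShrinkerGapReduction

section Shrinker

variable {n : ℕ} {M : Type} [TopologicalSpace M] [T2Space M] [SecondCountableTopology M]
  [ChartedSpace (EuclideanSpace ℝ (Fin n)) M] [IsManifold (𝓡 n) ∞ M] [ConnectedSpace M]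
  [T3Space M] [MeasurableSpace M] [BorelSpace M]

omit [T2Space M] [SecondCountableTopology M] [ConnectedSpace M] [T3Space M] [MeasurableSpace M]
  [BorelSpace M] in
/-- **`|∇(w e^{f/2})|² e^{-f} = |∇w|² + w g⁻¹(dw, df) + ¼ w² |∇f|²`**: the Leibniz rule
`d(w E) = w dE + E dw`, the chain rule `dE = (E/2) df` for `E = e^{f/2}`, bilinearity and symmetry
of `g⁻¹`, and `E² e^{-f} = 1`. [folklore] -/
theorem gradSq_mul_exp_half_mul_exp_neg
    (g : PseudoRiemannianMetric (𝓡 n) ∞ (EuclideanSpace ℝ (Fin n)) (TangentSpace (𝓡 n) : M → Type _))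
    {f w : M → ℝ} {x : M} (hfx : MDifferentiableAt (𝓡 n) 𝓘(ℝ, ℝ) f x)
    (hwx : MDifferentiableAt (𝓡 n) 𝓘(ℝ, ℝ) w x) :
    g.gradSq (fun y ↦ w y * Real.exp (f y / 2)) x * Real.exp (-f x) =
      g.gradSq w x + w x * g.innerDual x (mvfderiv (𝓡 n) w x).toLinearMap
        (mvfderiv (𝓡 n) f x).toLinearMap + (1 / 4 : ℝ) * (w x ^ 2 * g.gradSq f x) := by
  -- the chain rule `d(e^{f/2}) = (e^{f/2}/2) df`
  have hd : HasDerivAt (fun s : ℝ ↦ Real.exp (s / 2)) (Real.exp (f x / 2) / 2) (f x) :=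
    (((hasDerivAt_id' (f x)).div_const 2).exp).congr_deriv (by ring)
  have hR : Differentiable ℝ (fun s : ℝ ↦ Real.exp (s / 2)) :=
    Real.differentiable_exp.comp (differentiable_id.div_const (2 : ℝ))
  have hEx : MDifferentiableAt (𝓡 n) 𝓘(ℝ, ℝ) (fun y ↦ Real.exp (f y / 2)) x :=
    (hR.differentiableAt (x := f x)).comp_mdifferentiableAt hfx
  have hdE : (mvfderiv (𝓡 n) (fun y ↦ Real.exp (f y / 2)) x).toLinearMap =
      (Real.exp (f x / 2) / 2) • (mvfderiv (𝓡 n) f x).toLinearMap := by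
    ext u
    have := mvfderiv_real_comp_apply (I := 𝓡 n) hd hfx u
    simpa [Function.comp_def] using this
  -- the Leibniz rule
  have hdv : (mvfderiv (𝓡 n) (fun y ↦ w y * Real.exp (f y / 2)) x).toLinearMap =
      (w x * (Real.exp (f x / 2) / 2)) • (mvfderiv (𝓡 n) f x).toLinearMap +
        Real.exp (f x / 2) • (mvfderiv (𝓡 n) w x).toLinearMap := by
    rw [mvfderiv_fun_mul hwx hEx]
    simp [hdE, smul_smul]
  -- bilinearity and symmetry of `g⁻¹`
  have hsym := g.innerDual_comm x (mvfderiv (𝓡 n) f x).toLinearMap (mvfderiv (𝓡 n) w x).toLinearMap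
  simp only [PseudoRiemannianMetric.innerDual] at hsym
  have hE2 : Real.exp (f x / 2) ^ 2 * Real.exp (-f x) = 1 := by
    rw [sq, ← Real.exp_add, ← Real.exp_add, show f x / 2 + f x / 2 + -f x = 0 by ring, Real.exp_zero]
  simp only [PseudoRiemannianMetric.gradSq, PseudoRiemannianMetric.innerDual, hdv, map_add, map_smul,
    LinearMap.add_apply, LinearMap.smul_apply, smul_eq_mul]
  rw [hsym]
  linear_combination (w x ^ 2 / 4 * (mvfderiv (𝓡 n) f x).toLinearMap
      ((g.sharp x) (mvfderiv (𝓡 n) f x).toLinearMap) +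
    w x * (mvfderiv (𝓡 n) w x).toLinearMap ((g.sharp x) (mvfderiv (𝓡 n) f x).toLinearMap) +
    (mvfderiv (𝓡 n) w x).toLinearMap ((g.sharp x) (mvfderiv (𝓡 n) w x).toLinearMap)) * hE2

/-- **The `𝒲`-form of the compact-support LSI from its entropy form** (any dimension `n`): on a
complete connected normalised gradient shrinker, if every smooth compactly supported `v` satisfies
`∫ v² log v² e^{-f} − m log(m/Z) ≤ 4 ∫ |∇v|² e^{-f}` (`m = ∫ v² e^{-f}`, `Z = ∫ e^{-f}`), then every
smooth compactly supported `w` with `∫ w² > 0` satisfies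
`log((4π)^{-n/2} Z) ≤ (∫ (R w² + 4|∇w|² − w² log w²))/∫w² + log ∫w² + log (4π)^{-n/2} − n`.
Substitute `v = w e^{f/2}`; Green's identity for `w²` and `Δf = n/2 − R`, `|∇f|² = f − R`.
[cite: CarrilloNi2009, §4 (from the LSI of Thm. 3.1 to (4.1))] -/
theorem wForm_of_entForm
    (g : PseudoRiemannianMetric (𝓡 n) ∞ (EuclideanSpace ℝ (Fin n)) (TangentSpace (𝓡 n) : M → Type _))
    [g.HasLeviCivita] (f : M → ℝ) (hg : g.IsRiemannian)
    (hc : ∀ (x : M) (r : NNReal), IsCompact {y : M | g.edist hg x y ≤ r})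
    (hf : ContMDiff (𝓡 n) 𝓘(ℝ, ℝ) ∞ f)
    (hsol : ∀ (x : M) (X Y : TangentSpace (𝓡 n) x),
      g.ricci x X Y + g.hessian f x X Y = (1 / 2 : ℝ) * g.val x X Y)
    (hnorm : ∀ x : M, g.scalarCurvature x + g.gradSq f x = f x)
    (EF : ∀ v : M → ℝ, ContMDiff (𝓡 n) 𝓘(ℝ, ℝ) ∞ v → HasCompactSupport v →
      ∫ x, v x ^ 2 * Real.log (v x ^ 2) * Real.exp (-f x) ∂g.riemVolume -
        (∫ x, v x ^ 2 * Real.exp (-f x) ∂g.riemVolume) *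
          Real.log ((∫ x, v x ^ 2 * Real.exp (-f x) ∂g.riemVolume) /
            (∫ x, Real.exp (-f x) ∂g.riemVolume)) ≤
      4 * ∫ x, g.gradSq v x * Real.exp (-f x) ∂g.riemVolume)
    {w : M → ℝ} (hw : ContMDiff (𝓡 n) 𝓘(ℝ, ℝ) ∞ w) (hwc : HasCompactSupport w)
    (hm : 0 < ∫ x, w x ^ 2 ∂g.riemVolume) :
    Real.log ((4 * Real.pi) ^ (-(n : ℝ) / 2) * ∫ x, Real.exp (-f x) ∂g.riemVolume) ≤
      (∫ x, (g.scalarCurvature x * w x ^ 2 + 4 * g.gradSq w x - w x ^ 2 * Real.log (w x ^ 2))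
          ∂g.riemVolume) / (∫ x, w x ^ 2 ∂g.riemVolume) + Real.log (∫ x, w x ^ 2 ∂g.riemVolume) +
        Real.log ((4 * Real.pi) ^ (-(n : ℝ) / 2)) - n := by
  classical
  haveI := CarrilloNi2009_shrinkerLSI.isFiniteMeasureOnCompacts_riemVolume hg
  haveI : LocallyCompactSpace M := Manifold.locallyCompact_of_finiteDimensional (𝓡 n)
  /- `M` is nonempty and `Z = ∫ e^{-f} > 0` (Carrillo–Ni, Thm. 1.1 (i)) -/
  obtain ⟨-, hne, -⟩ := scalarCurvature_nonneg_and_isCompact_sublevel g f hg hc hf hsol hnorm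
  have hZi : Integrable (fun x ↦ Real.exp (-f x)) g.riemVolume :=
    carrilloNi_integrable_exp_neg g f hg hc hf hsol hnorm
  have hZ : 0 < ∫ x, Real.exp (-f x) ∂g.riemVolume := integral_exp_neg_pos hg hZi
  have hA4 : 0 < (4 * Real.pi) ^ (-(n : ℝ) / 2) := Real.rpow_pos_of_pos (by positivity) _
  /- the soliton identities -/
  have hΔf : ∀ x, g.dalembertian f x = n / 2 - g.scalarCurvature x := fun x ↦ by
    linarith [CarrilloNi2009_shrinkerLSI.scalarCurvature_add_dalembertian hsol x]
  have hgradf : ∀ x, g.gradSq f x = f x - g.scalarCurvature x := fun x ↦ by linarith [hnorm x]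
  /- continuity and support bookkeeping; integrability of the basic integrands -/
  have hScont : Continuous fun x ↦ g.scalarCurvature x :=
    (PseudoRiemannianMetric.contMDiff_scalarCurvature g).continuous
  have hIcont : ∀ {φ ψ : M → ℝ}, ContMDiff (𝓡 n) 𝓘(ℝ, ℝ) ∞ φ → ContMDiff (𝓡 n) 𝓘(ℝ, ℝ) ∞ ψ →
      Continuous fun x ↦ g.innerDual x (mvfderiv (𝓡 n) φ x).toLinearMap
        (mvfderiv (𝓡 n) ψ x).toLinearMap :=
    fun hφ hψ ↦ continuous_innerDual_mvfderiv g (hφ.of_le (by norm_num)) (hψ.of_le (by norm_num))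
  have hgradcont : ∀ {φ : M → ℝ}, ContMDiff (𝓡 n) 𝓘(ℝ, ℝ) ∞ φ → Continuous (g.gradSq φ) :=
    fun hφ ↦ hIcont hφ hφ
  have hwcont : Continuous w := hw.continuous
  have hw0 : ∀ x, x ∉ tsupport w → w x = 0 := fun x hx ↦ image_eq_zero_of_notMem_tsupport hx
  have hdw0 : ∀ x, x ∉ tsupport w → mvfderiv (𝓡 n) w x = 0 := fun x hx ↦
    mvfderiv_eq_zero_of_notMem_tsupport hx
  have hgw0 : ∀ x, x ∉ tsupport w → g.gradSq w x = 0 := fun x hx ↦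
    g.gradSq_eq_zero_of_mvfderiv_eq_zero (hdw0 x hx)
  have intK : ∀ {F : M → ℝ}, Continuous F → (∀ x, x ∉ tsupport w → F x = 0) →
      Integrable F g.riemVolume := fun hF h0 ↦
    hF.integrable_of_hasCompactSupport (HasCompactSupport.intro hwc h0)
  have iw2 : Integrable (fun x ↦ w x ^ 2) g.riemVolume :=
    intK (hwcont.pow 2) (fun x hx ↦ by simp [hw0 x hx])
  have iA : Integrable (fun x ↦ g.scalarCurvature x * w x ^ 2) g.riemVolume :=
    intK (hScont.mul (hwcont.pow 2)) (fun x hx ↦ by simp [hw0 x hx])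
  have iB : Integrable (fun x ↦ g.gradSq w x) g.riemVolume :=
    intK (hgradcont hw) (fun x hx ↦ hgw0 x hx)
  have iC : Integrable (fun x ↦ w x ^ 2 * Real.log (w x ^ 2)) g.riemVolume :=
    intK (Real.continuous_mul_log.comp (hwcont.pow 2)) (fun x hx ↦ by simp [hw0 x hx])
  have iD : Integrable (fun x ↦ f x * w x ^ 2) g.riemVolume :=
    intK (hf.continuous.mul (hwcont.pow 2)) (fun x hx ↦ by simp [hw0 x hx])
  have iX : Integrable (fun x ↦ w x * g.innerDual x (mvfderiv (𝓡 n) w x).toLinearMap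
      (mvfderiv (𝓡 n) f x).toLinearMap) g.riemVolume :=
    intK (hwcont.mul (hIcont hw hf)) (fun x hx ↦ by simp [hw0 x hx])
  have iWG : Integrable (fun x ↦ w x ^ 2 * g.gradSq f x) g.riemVolume :=
    intK ((hwcont.pow 2).mul (hgradcont hf)) (fun x hx ↦ by simp [hw0 x hx])
  /- the numerator `N = A + 4B − C` -/
  have hN : ∫ x, (g.scalarCurvature x * w x ^ 2 + 4 * g.gradSq w x - w x ^ 2 * Real.log (w x ^ 2))
      ∂g.riemVolume = ∫ x, g.scalarCurvature x * w x ^ 2 ∂g.riemVolume +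
        4 * ∫ x, g.gradSq w x ∂g.riemVolume - ∫ x, w x ^ 2 * Real.log (w x ^ 2) ∂g.riemVolume := by
    have i1 : Integrable (fun x ↦ g.scalarCurvature x * w x ^ 2 + 4 * g.gradSq w x) g.riemVolume :=
      iA.add (iB.const_mul 4)
    rw [integral_sub i1 iC, integral_add iA (iB.const_mul 4), integral_const_mul]
  /- `∫ w² |∇f|² = ∫ f w² − ∫ R w²` -/
  have hWG : ∫ x, w x ^ 2 * g.gradSq f x ∂g.riemVolume =
      ∫ x, f x * w x ^ 2 ∂g.riemVolume - ∫ x, g.scalarCurvature x * w x ^ 2 ∂g.riemVolume := by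
    rw [← integral_sub iD iA]
    refine integral_congr_ae (ae_of_all _ fun x ↦ ?_)
    dsimp only
    rw [hgradf x]
    ring
  /- Green's first identity for the compactly supported `w²`: `2 ∫ w g⁻¹(dw, df) = ∫ R w² − (n/2) ∫ w²` -/
  have hww1 : ContMDiff (𝓡 n) 𝓘(ℝ, ℝ) 1 (fun y ↦ w y * w y) := (hw.mul hw).of_le ENat.LEInfty.out
  have hwwc : HasCompactSupport (fun y ↦ w y * w y) := hwc.mul_right
  have hf2 : ContMDiff (𝓡 n) 𝓘(ℝ, ℝ) 2 f := hf.of_le ENat.LEInfty.out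
  have hGreen : ∫ x, (w x * w x) * g.dalembertian f x ∂g.riemVolume =
      -∫ x, g.innerDual x (mvfderiv (𝓡 n) (fun y ↦ w y * w y) x).toLinearMap
        (mvfderiv (𝓡 n) f x).toLinearMap ∂g.riemVolume := by
    haveI := (PseudoRiemannianMetric.ofRiemannian (g.toContMDiffRiemannianMetric hg)).hasLeviCivita
    have h1 := integral_mul_dalembertian_eq_neg_integral_innerDual_of_hasCompactSupport
      (g.toContMDiffRiemannianMetric hg) hww1 hwwc hf2
    rw [PseudoRiemannianMetric.riemVolume_eq hg]
    exact h1
  have hX : 2 * ∫ x, w x * g.innerDual x (mvfderiv (𝓡 n) w x).toLinearMap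
      (mvfderiv (𝓡 n) f x).toLinearMap ∂g.riemVolume =
      ∫ x, g.scalarCurvature x * w x ^ 2 ∂g.riemVolume - n / 2 * ∫ x, w x ^ 2 ∂g.riemVolume := by
    have hL : ∫ x, (w x * w x) * g.dalembertian f x ∂g.riemVolume =
        n / 2 * ∫ x, w x ^ 2 ∂g.riemVolume - ∫ x, g.scalarCurvature x * w x ^ 2 ∂g.riemVolume := by
      rw [← integral_const_mul, ← integral_sub (iw2.const_mul _) iA]
      refine integral_congr_ae (ae_of_all _ fun x ↦ ?_)
      dsimp only
      rw [hΔf x]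
      ring
    have hR : ∫ x, g.innerDual x (mvfderiv (𝓡 n) (fun y ↦ w y * w y) x).toLinearMap
        (mvfderiv (𝓡 n) f x).toLinearMap ∂g.riemVolume =
        2 * ∫ x, w x * g.innerDual x (mvfderiv (𝓡 n) w x).toLinearMap
          (mvfderiv (𝓡 n) f x).toLinearMap ∂g.riemVolume := by
      rw [← integral_const_mul]
      refine integral_congr_ae (ae_of_all _ fun x ↦ ?_)
      dsimp only
      have hwx : MDifferentiableAt (𝓡 n) 𝓘(ℝ, ℝ) w x := hw.mdifferentiableAt (by norm_num)
      have hd : (mvfderiv (𝓡 n) (fun y ↦ w y * w y) x).toLinearMap =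
          w x • (mvfderiv (𝓡 n) w x).toLinearMap + w x • (mvfderiv (𝓡 n) w x).toLinearMap := by
        rw [mvfderiv_fun_mul hwx hwx]
        simp
      rw [hd]
      simp only [PseudoRiemannianMetric.innerDual, LinearMap.add_apply, LinearMap.smul_apply,
        smul_eq_mul]
      ring
    rw [hR] at hGreen
    linarith
  /- the substitution `v = w e^{f/2}` -/
  set v : M → ℝ := fun y ↦ w y * Real.exp (f y / 2) with hv
  have hEs : ContMDiff (𝓡 n) 𝓘(ℝ, ℝ) ∞ (fun y ↦ Real.exp (f y / 2)) :=
    (Real.contDiff_exp.comp (contDiff_id.div_const 2)).comp_contMDiff hf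
  have hvs : ContMDiff (𝓡 n) 𝓘(ℝ, ℝ) ∞ v := hw.mul hEs
  have hvc : HasCompactSupport v := hwc.mul_right
  have hexp2 : ∀ x, Real.exp (f x / 2) ^ 2 = Real.exp (f x) := fun x ↦ by
    rw [sq, ← Real.exp_add, add_halves]
  have hexp1 : ∀ x, Real.exp (f x) * Real.exp (-f x) = 1 := fun x ↦ by
    rw [← Real.exp_add, add_neg_cancel, Real.exp_zero]
  have hv2 : ∀ x, v x ^ 2 = w x ^ 2 * Real.exp (f x) := fun x ↦ by
    simp only [hv]
    rw [mul_pow, hexp2]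
  have hvw : ∀ x, v x ^ 2 * Real.exp (-f x) = w x ^ 2 := fun x ↦ by
    rw [hv2 x, mul_assoc, hexp1 x, mul_one]
  have hvlog : ∀ x, v x ^ 2 * Real.log (v x ^ 2) * Real.exp (-f x) =
      w x ^ 2 * Real.log (w x ^ 2) + f x * w x ^ 2 := fun x ↦ by
    by_cases hwx : w x = 0
    · simp [hv2 x, hwx]
    · rw [hv2 x, Real.log_mul (pow_ne_zero 2 hwx) (Real.exp_ne_zero _), Real.log_exp]
      linear_combination (w x ^ 2 * (Real.log (w x ^ 2) + f x)) * hexp1 x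
  have hvgrad : ∀ x, g.gradSq v x * Real.exp (-f x) =
      g.gradSq w x + w x * g.innerDual x (mvfderiv (𝓡 n) w x).toLinearMap
        (mvfderiv (𝓡 n) f x).toLinearMap + (1 / 4 : ℝ) * (w x ^ 2 * g.gradSq f x) := fun x ↦
    gradSq_mul_exp_half_mul_exp_neg g (hf.mdifferentiableAt (by norm_num))
      (hw.mdifferentiableAt (by norm_num))
  have hI1 : ∫ x, v x ^ 2 * Real.exp (-f x) ∂g.riemVolume = ∫ x, w x ^ 2 ∂g.riemVolume :=
    integral_congr_ae (ae_of_all _ hvw)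
  have hI2 : ∫ x, v x ^ 2 * Real.log (v x ^ 2) * Real.exp (-f x) ∂g.riemVolume =
      ∫ x, w x ^ 2 * Real.log (w x ^ 2) ∂g.riemVolume + ∫ x, f x * w x ^ 2 ∂g.riemVolume := by
    rw [← integral_add iC iD]
    exact integral_congr_ae (ae_of_all _ hvlog)
  have hI3 : ∫ x, g.gradSq v x * Real.exp (-f x) ∂g.riemVolume =
      ∫ x, g.gradSq w x ∂g.riemVolume + ∫ x, w x * g.innerDual x (mvfderiv (𝓡 n) w x).toLinearMap
        (mvfderiv (𝓡 n) f x).toLinearMap ∂g.riemVolume +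
        (1 / 4 : ℝ) * (∫ x, f x * w x ^ 2 ∂g.riemVolume -
          ∫ x, g.scalarCurvature x * w x ^ 2 ∂g.riemVolume) := by
    have i2 : Integrable (fun x ↦ g.gradSq w x + w x * g.innerDual x
        (mvfderiv (𝓡 n) w x).toLinearMap (mvfderiv (𝓡 n) f x).toLinearMap) g.riemVolume :=
      iB.add iX
    have i3 : Integrable (fun x ↦ (1 / 4 : ℝ) * (w x ^ 2 * g.gradSq f x)) g.riemVolume :=
      iWG.const_mul _
    rw [← hWG, ← integral_const_mul, ← integral_add iB iX, ← integral_add i2 i3]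
    exact integral_congr_ae (ae_of_all _ hvgrad)
  /- the entropy form for `v`, and the algebra -/
  have hEF := EF v hvs hvc
  rw [hI1, hI2, hI3, Real.log_div hm.ne' hZ.ne'] at hEF
  rw [Real.log_mul hA4.ne' hZ.ne', hN]
  have key : Real.log (∫ x, Real.exp (-f x) ∂g.riemVolume) + n -
      Real.log (∫ x, w x ^ 2 ∂g.riemVolume) ≤
      (∫ x, g.scalarCurvature x * w x ^ 2 ∂g.riemVolume + 4 * ∫ x, g.gradSq w x ∂g.riemVolume -
        ∫ x, w x ^ 2 * Real.log (w x ^ 2) ∂g.riemVolume) / ∫ x, w x ^ 2 ∂g.riemVolume := by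
    rw [le_div_iff₀ hm]
    linarith
  linarith

end Shrinker

/-! ## The registered stub (`n = 4`) -/

/-- **Stub `helper_wForm_of_entForm` of line `collapsed-ends-usc`**: on a complete connected
normalised 4-d gradient shrinker, the entropy form of the compact-support LSI for every smooth
compactly supported `v` (`∫ v² log v² e^{-f} − m log(m/Z) ≤ 4 ∫ |∇v|² e^{-f}`) implies Perelman's
`𝒲`-form `log((4π)⁻² ∫ e^{-f}) ≤ (∫ (R w² + 4|∇w|² − w² log w²))/∫w² + log ∫w² − log (4π)² − 4` for
every smooth compactly supported `w` with `∫ w² > 0` (`wForm_of_entForm` at `n = 4`; the bound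
`R ≤ C` is not used). [cite: CarrilloNi2009, §4 (from the LSI of Thm. 3.1 to (4.1))] -/
theorem helper_wForm_of_entForm : ∀ (M : Type) [TopologicalSpace M] [T2Space M] [SecondCountableTopology M] [ChartedSpace (EuclideanSpace ℝ (Fin 4)) M] [IsManifold (𝓡 4) ∞ M] [ConnectedSpace M] [T3Space M] [MeasurableSpace M] [BorelSpace M] (g : PseudoRiemannianMetric (𝓡 4) ∞ (EuclideanSpace ℝ (Fin 4)) (TangentSpace (𝓡 4) : M → Type _)) [g.HasLeviCivita] (f : M → ℝ) (hg : g.IsRiemannian), (∀ (x : M) (r : NNReal), IsCompact {y : M | g.edist hg x y ≤ r}) → ContMDiff (𝓡 4) 𝓘(ℝ, ℝ) ∞ f → (∀ (x : M) (X Y : TangentSpace (𝓡 4) x), g.ricci x X Y + g.hessian f x X Y = (1 / 2 : ℝ) * g.val x X Y) → (∀ x : M, g.scalarCurvature x + g.gradSq f x = f x) → (∀ v : M → ℝ, ContMDiff (𝓡 4) 𝓘(ℝ, ℝ) ∞ v → HasCompactSupport v → ∫ x, v x ^ 2 * Real.log (v x ^ 2) * Real.exp (-f x) ∂g.riemVolume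 - (∫ x, v x ^ 2 * Real.exp (-f x) ∂g.riemVolume) * Real.log ((∫ x, v x ^ 2 * Real.exp (-f x) ∂g.riemVolume) / (∫ x, Real.exp (-f x) ∂g.riemVolume)) ≤ 4 * ∫ x, g.gradSq v x * Real.exp (-f x) ∂g.riemVolume) → (∃ C : ℝ, ∀ x : M, g.scalarCurvature x ≤ C) → ∀ w : M → ℝ, ContMDiff (𝓡 4) 𝓘(ℝ, ℝ) ∞ w → HasCompactSupport w → 0 < ∫ x, w x ^ 2 ∂g.riemVolume → Real.log ((4 * Real.pi) ^ (-(4 : ℝ) / 2) * ∫ x, Real.exp (-f x) ∂g.riemVolume) ≤ (∫ x, (g.scalarCurvature x * w x ^ 2 + 4 * g.gradSq w x - w x ^ 2 * Real.log (w x ^ 2)) ∂g.riemVolume) / (∫ x, w x ^ 2 ∂g.riemVolume) + Real.log (∫ x, w x ^ 2 ∂g.riemVolume) - Real.log ((4 * Real.pi) ^ 2) - 4 := by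
  intro M _ _ _ _ _ _ _ _ _ g _ f hg hc hf hsol hnorm EF _ w hw hwc hm
  have h := wForm_of_entForm (n := 4) g f hg hc hf hsol hnorm EF hw hwc hm
  have hlogA : Real.log ((4 * Real.pi) ^ (-(4 : ℝ) / 2)) = -Real.log ((4 * Real.pi) ^ 2) := by
    rw [show (-(4 : ℝ) / 2) = -(2 : ℝ) by norm_num, Real.rpow_neg (by positivity), Real.log_inv,
      Real.rpow_two]
  simp only [Nat.cast_ofNat] at h
  rw [hlogA] at h
  linarith

end Summit.SmoothPoincare4.SmoothPoincare4.Theorems.NoncompactShrinkerGapHeat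

end
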